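import Literature.NumberTheory.Automorphic.Liu2021.Thm418Invariants
import Literature.NumberTheory.Automorphic.Liu2021.Def411AsPrinted
import Literature.NumberTheory.Automorphic.Liu2021.Prop46AsPrinted
import HarnessLib

/-!
# [Liu2021, Thm. 4.18] + [Def. 4.11] + [Prop. 4.6 (1)] AS PRINTED ⟹ `Hom_E(A_K, A_μ)_ℚ ≠ 0` at small level — by name

Reproduction (Literature): kernel-checked consequences of THREE statement-exact records of [Liu2021] over the same datum
`D : Thm418Data F E` — `Thm418AsPrinted D` (Thm. 4.18, `Thm418AsPrinted.lean`), `Def411AsPrinted D` (Def. 4.11,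
`Def411AsPrinted.lean`) and `Prop46_1AsPrinted D 𝒜` (Prop. 4.6 (1), `Prop46AsPrinted.lean`) — composed with the
bookkeeping of `Thm418Invariants.lean`.  No new axioms, no records, no definitions, nothing asserted.

WHY.  The supply-side consumers of Thm. 4.18 (Hodge/CM programme, transposition item (vi) S2) take, beside the cite
binder `(hLiu : Thm418AsPrinted D)`, the binders `hObj : Nonempty D.Obj` («`𝒜(μ)` is non-empty»), `hirr` («`ω_i`
irreducible»), `hsm` («`ω_i` smooth») and a non-vanishing input.  With the two sibling records now in the tree these
become CITE-AS-PRINTED, and this file packages the substitution under ONE name per shape, so that a consumer writes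
`Thm418Data.exists_obj_homK_ne_zero_of_asPrinted hLiu h46 h411 hnv` and nothing else:

* `Thm418Data.exists_homK_ne_zero_of_isSmoothRep` — THE EXACT INPUT LIST: Thm. 4.18 as printed, an object `D_μ`, ONE
  `μ`-admissible index `i = (ε, χ)` whose `ω_i` is a NON-ZERO space, and SMOOTHNESS of that one `ω_i`
  (`IsSmoothRep (D.rhoAt i)`) ⟹ an open compact `K₀` with `Hom_E(A_K, A_μ)_ℚ ∋ φ ≠ 0` for EVERY open compact `K ≤ K₀`.
  STRENGTH REMARK (binder audit): «irreducible» and «admissible» (finite-dimensional invariants) are NOT used anywhere on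
  this path — of Def. 4.11's printed adjectives only «smooth» is consumed, and only at one index.
* `Thm418Data.exists_homK_ne_zero_of_def411` — the same with smoothness cited AS PRINTED (`Def411AsPrinted D`);
  `exists_homK_ne_zero_le_of_def411` — for a GIVEN object `D_μ`, a level below a prescribed open compact `K′`.
* `Thm418Data.exists_obj_homK_ne_zero_of_asPrinted` / `exists_obj_level_homK_ne_zero_of_asPrinted` /
  `exists_obj_homK_ne_zero_le_of_asPrinted` — with the object `D_μ ∈ 𝒜(μ)` taken from Prop. 4.6 (1) AS PRINTED
  (`Prop46_1AsPrinted D 𝒜`): all levels below a threshold / one level / a level below a prescribed open compact `K′`.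
* `Thm418Data.exists_obj_homK_ne_zero_of_asPrinted_of_forall` — the variant whose non-vanishing input is phrased as the
  consumers phrase App. D Lem. D.1 (1) for `n ≥ 3` («EVERY `ω(μ, ε, χ)` is non-zero») plus one automorphic character `χ`.

THE ONE NON-RECORD INPUT.  `hnv : ∃ i : D.AdmIndex, Nontrivial (D.omegaAt i)` — some `μ`-admissible summand
`ω(μ, ε, χ)` is a non-zero space.  In print this is App. D, Lem. D.1 (1) (l. 5226–5229: the LOCAL oscillator
representation is zero iff `E_v` is a field, `V` is anisotropic — in particular `n = 2` — and `χ̌ = μ²`; so for `n ≥ 3`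
every local factor, hence the restricted tensor product, is non-zero).  It is a statement about LOCAL factors, not
typeable on the global carrier `D.omega` (ruling READING I1 of `Def411AsPrinted`), and it is NOT a consequence of
Thm. 4.18 + Def. 4.11 + Prop. 4.6 (1) as typed: at the datum with all `ω(μ,ε,χ) := 0` and `Ω(μ) := 0`,
`Hom := 0` the three records hold and the conclusion fails (`records_hold_at_zeroDatum` below — so `hnv` is
load-bearing, not decorative).  It therefore stays the consumer's ONE explicit non-record hypothesis.

* `Thm418Data.records_consistent` — T5 CONSISTENCY CERTIFICATE: a datum and a morphism carrier at which ALL hypotheses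
  used in this file hold at once (`Thm418AsPrinted ∧ Prop46_1AsPrinted ∧ Def411AsPrinted ∧ ∀ ε χ, Nontrivial ω ∧
  Nonempty Chi`); no contradiction is derivable from any binder set below.
* `Thm418Data.records_hold_at_zeroDatum` — the necessity witness for `hnv` just described.

References (context only; every declaration below is proved): Y. Liu, *Fourier–Jacobi cycles and arithmetic relative
trace formula*, Camb. J. Math. 9 (2021) = arXiv:2102.11518 (`FJcycle.tex` md5 6db49a74122d), Prop. 4.6 (1) l. 1969,
Def. 4.11 l. 2083–2097, Def. 4.12, Thm. 4.18 l. 2232–2245, App. D Lem. D.1 (1) l. 5226–5229.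
-/

noncomputable section

open NumberField TensorProduct DirectSum CategoryTheory

namespace Literature.NumberTheory.Automorphic.Liu2021

namespace Thm418Data

variable {F E : Type} [Field F] [NumberField F] [IsTotallyReal F] [Field E] [NumberField E] [Algebra F E]
  [IsTotallyComplex E] [Algebra.IsQuadraticExtension F E] {D : Thm418Data F E}

/-! ## The exact input list: Thm. 4.18, an object, one non-zero admissible summand, its smoothness -/

/-- **Thm. 4.18 (main) + (1) + smoothness of ONE non-zero admissible summand ⟹ `Hom_E(A_K, A_μ)_ℚ ≠ 0` at every small
level.**  Inputs: `Thm418AsPrinted D`; an object `D_μ ∈ 𝒜(μ)`; a `μ`-admissible index `i = (ε, χ)` with `ω_i` a non-zero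
space; `ω_i` SMOOTH (`IsSmoothRep`: every vector fixed by an open subgroup — [Liu2021] Def. 4.11 «admissible
representation of `𝔾(𝔸_F^∞)`», READING I2).  Proof: a non-zero `v ∈ ω_i` is fixed by an open `S`; `S ∩ K₀(D_μ)` (the
item-(1) threshold, open compact) is open compact and fixes `v`; conclude by `exists_homK_ne_zero`.  «Irreducible» and
finite-dimensionality of invariants are NOT used.  Our bookkeeping. [cite: Liu2021, Thm. 4.18 (1) and Def. 4.11] -/
theorem exists_homK_ne_zero_of_isSmoothRep (h : Liu2021.Thm418AsPrinted D) (Dμ : D.Obj) (i : D.AdmIndex)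
    [Nontrivial (D.omegaAt i)] (hsm : IsSmoothRep (D.rhoAt i)) :
    ∃ K₀ : Subgroup D.G, IsOpenCompact K₀ ∧
      ∀ K : Subgroup D.G, IsOpenCompact K → K ≤ K₀ → ∃ φ : D.HomK K Dμ, φ ≠ 0 := by
  obtain ⟨v, hv⟩ := exists_ne (0 : D.omegaAt i)
  obtain ⟨S, hS, hSv⟩ := hsm v
  have h' := h
  obtain ⟨-, -, h1, -, -⟩ := h'
  obtain ⟨K₂, hK₂, -⟩ := h1 Dμ
  have hK₁ : IsOpenCompact (S ⊓ K₂) := by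
    refine ⟨?_, ?_⟩ <;> rw [Subgroup.coe_inf]
    · exact hS.inter hK₂.1
    · exact hK₂.2.inter_left (Subgroup.isClosed_of_isOpen S hS)
  exact exists_homK_ne_zero h Dμ i hK₁ hv (fun k hk => hSv k (inf_le_left (a := S) hk))

/-- **The same with smoothness cited AS PRINTED**: `Def411AsPrinted D` ([Liu2021] Def. 4.11 exactly as printed: every
`ω(μ, ε, χ)` is irreducible-or-zero, smooth and admissible) supplies `IsSmoothRep (D.rhoAt i)`; only that conjunct is
used. [cite: Liu2021, Thm. 4.18 (1) and Def. 4.11] -/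
theorem exists_homK_ne_zero_of_def411 (h : Liu2021.Thm418AsPrinted D) (h411 : Liu2021.Def411AsPrinted D)
    (Dμ : D.Obj) (i : D.AdmIndex) [Nontrivial (D.omegaAt i)] :
    ∃ K₀ : Subgroup D.G, IsOpenCompact K₀ ∧
      ∀ K : Subgroup D.G, IsOpenCompact K → K ≤ K₀ → ∃ φ : D.HomK K Dμ, φ ≠ 0 :=
  exists_homK_ne_zero_of_isSmoothRep h Dμ i (h411 i.1.1 i.1.2).2.1

/-! ## With the object taken from Prop. 4.6 (1) as printed -/

/-- **Thm. 4.18 + Prop. 4.6 (1) + Def. 4.11 AS PRINTED + one non-zero admissible summand ⟹ for SOME object `D_μ ∈ 𝒜(μ)`,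
`Hom_E(A_K, A_μ)_ℚ ≠ 0` at every open compact `K` below some open compact `K₀`.**  The object is «`𝒜(μ)` is nonempty»
(`Prop46_1AsPrinted D 𝒜`, conjunct one; `𝒜` = the consumer's morphism carrier, unused beyond that); smoothness is Def. 4.11
as printed; `hnv` («some `μ`-admissible `ω(μ,ε,χ)` is a non-zero space») is App. D Lem. D.1 (1) in the consumer's hands —
the one non-record input (module docstring). [cite: Liu2021, Thm. 4.18 (1), Prop. 4.6 (1) and Def. 4.11] -/
theorem exists_obj_homK_ne_zero_of_asPrinted {𝒜 : SmallCategory D.Obj} (h : Liu2021.Thm418AsPrinted D)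
    (h46 : Liu2021.Prop46_1AsPrinted D 𝒜) (h411 : Liu2021.Def411AsPrinted D)
    (hnv : ∃ i : D.AdmIndex, Nontrivial (D.omegaAt i)) :
    ∃ (Dμ : D.Obj) (K₀ : Subgroup D.G), IsOpenCompact K₀ ∧
      ∀ K : Subgroup D.G, IsOpenCompact K → K ≤ K₀ → ∃ φ : D.HomK K Dμ, φ ≠ 0 := by
  obtain ⟨Dμ⟩ := nonempty_obj h46
  obtain ⟨i, hi⟩ := hnv
  exact ⟨Dμ, exists_homK_ne_zero_of_def411 h h411 Dμ i⟩

/-- The same at ONE level: some object `D_μ` and some open compact `K` with `Hom_E(A_K, A_μ)_ℚ ∋ φ ≠ 0`.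
[cite: Liu2021, Thm. 4.18 (1), Prop. 4.6 (1) and Def. 4.11] -/
theorem exists_obj_level_homK_ne_zero_of_asPrinted {𝒜 : SmallCategory D.Obj} (h : Liu2021.Thm418AsPrinted D)
    (h46 : Liu2021.Prop46_1AsPrinted D 𝒜) (h411 : Liu2021.Def411AsPrinted D)
    (hnv : ∃ i : D.AdmIndex, Nontrivial (D.omegaAt i)) :
    ∃ (Dμ : D.Obj) (K : Subgroup D.G), IsOpenCompact K ∧ ∃ φ : D.HomK K Dμ, φ ≠ 0 := by
  obtain ⟨Dμ, K₀, hK₀, hK⟩ := exists_obj_homK_ne_zero_of_asPrinted h h46 h411 hnv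
  exact ⟨Dμ, K₀, hK₀, hK K₀ hK₀ le_rfl⟩

/-- **Below a prescribed level** (e.g. a neat one, so that the consumer's `X_K` has smooth components): some object `D_μ`
and some open compact `K ≤ K′` with `Hom_E(A_K, A_μ)_ℚ ∋ φ ≠ 0` (take `K := K₀ ∩ K′`).
[cite: Liu2021, Thm. 4.18 (1), Prop. 4.6 (1) and Def. 4.11] -/
theorem exists_obj_homK_ne_zero_le_of_asPrinted {𝒜 : SmallCategory D.Obj} (h : Liu2021.Thm418AsPrinted D)
    (h46 : Liu2021.Prop46_1AsPrinted D 𝒜) (h411 : Liu2021.Def411AsPrinted D)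
    (hnv : ∃ i : D.AdmIndex, Nontrivial (D.omegaAt i)) {K' : Subgroup D.G} (hK' : IsOpenCompact K') :
    ∃ (Dμ : D.Obj) (K : Subgroup D.G), IsOpenCompact K ∧ K ≤ K' ∧ ∃ φ : D.HomK K Dμ, φ ≠ 0 := by
  obtain ⟨Dμ, K₀, hK₀, hK⟩ := exists_obj_homK_ne_zero_of_asPrinted h h46 h411 hnv
  have hKK : IsOpenCompact (K₀ ⊓ K') := by
    refine ⟨?_, ?_⟩ <;> rw [Subgroup.coe_inf]
    · exact hK₀.1.inter hK'.1
    · exact hK₀.2.inter_right (Subgroup.isClosed_of_isOpen K' hK'.1)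
  exact ⟨Dμ, K₀ ⊓ K', hKK, inf_le_right, hK _ hKK inf_le_left⟩

/-- **A prescribed object, below a prescribed level.**  For a GIVEN object `D_μ` (a consumer whose pin `A_μ` is attached
to a specific `D_μ` keeps it), smoothness cited as printed and one non-zero admissible summand: some open compact `K ≤ K′`
has `Hom_E(A_K, A_μ)_ℚ ∋ φ ≠ 0`. [cite: Liu2021, Thm. 4.18 (1) and Def. 4.11] -/
theorem exists_homK_ne_zero_le_of_def411 (h : Liu2021.Thm418AsPrinted D) (h411 : Liu2021.Def411AsPrinted D)
    (Dμ : D.Obj) (i : D.AdmIndex) [Nontrivial (D.omegaAt i)] {K' : Subgroup D.G} (hK' : IsOpenCompact K') :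
    ∃ K : Subgroup D.G, IsOpenCompact K ∧ K ≤ K' ∧ ∃ φ : D.HomK K Dμ, φ ≠ 0 := by
  obtain ⟨K₀, hK₀, hK⟩ := exists_homK_ne_zero_of_def411 h h411 Dμ i
  have hKK : IsOpenCompact (K₀ ⊓ K') := by
    refine ⟨?_, ?_⟩ <;> rw [Subgroup.coe_inf]
    · exact hK₀.1.inter hK'.1
    · exact hK₀.2.inter_right (Subgroup.isClosed_of_isOpen K' hK'.1)
  exact ⟨K₀ ⊓ K', hKK, inf_le_right, hK _ hKK inf_le_left⟩

/-- **Variant in the words consumers use for App. D Lem. D.1 (1) at `n ≥ 3`** («EVERY `ω(μ, ε, χ)` is non-zero», here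
only asked at the `μ`-admissible indices `i : D.AdmIndex` of Thm. 4.18's direct sum): with one automorphic character `χ`
(e.g. the trivial one — the carrier `Chi` is the consumer's) a `μ`-admissible index exists (`nonempty_admIndex`,
Def. 4.12 by weak approximation), and `exists_obj_homK_ne_zero_of_asPrinted` applies.
[cite: Liu2021, Thm. 4.18 (1), Prop. 4.6 (1), Def. 4.11 and Def. 4.12] -/
theorem exists_obj_homK_ne_zero_of_asPrinted_of_forall {𝒜 : SmallCategory D.Obj} (h : Liu2021.Thm418AsPrinted D)
    (h46 : Liu2021.Prop46_1AsPrinted D 𝒜) (h411 : Liu2021.Def411AsPrinted D) (χ : D.Chi)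
    (hnv : ∀ i : D.AdmIndex, Nontrivial (D.omegaAt i)) :
    ∃ (Dμ : D.Obj) (K₀ : Subgroup D.G), IsOpenCompact K₀ ∧
      ∀ K : Subgroup D.G, IsOpenCompact K → K ≤ K₀ → ∃ φ : D.HomK K Dμ, φ ≠ 0 := by
  obtain ⟨i⟩ := nonempty_admIndex (D := D) χ
  exact exists_obj_homK_ne_zero_of_asPrinted h h46 h411 ⟨i, hnv i⟩

/-! ## Consistency certificate (tribunal item T5) and the necessity of the non-vanishing input -/

/-- **T5 consistency certificate — the SCALAR DATUM satisfies all three records and the non-vanishing input at once.**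
Over every CM extension `E/F` as in l. 1878 there are a datum `D : Thm418Data F E` and a morphism carrier `𝒜` with
`Thm418AsPrinted D ∧ Prop46_1AsPrinted D 𝒜 ∧ Def411AsPrinted D ∧ (∀ ε χ, Nontrivial (ω(μ,ε,χ))) ∧ Nonempty Chi`: the
datum `𝔾 := PUnit`, `Eps := Chi := PUnit`, `Obj :=` the one-object discrete category, `μ` a weight-one conjugate
symplectic character (tree `IdeleClassGroup.exists_isConjugateSymplectic_hasCMType`), `ω := ℂ` with the trivial action
(irreducible-or-zero: a `ℂ`-subspace of `ℂ` is `0` or `ℂ`; smooth; admissible: finite-dimensional), `Ω(μ) := M_μ`,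
`Hom := M_μ`, `res := id`.  Hence NO contradiction is derivable from any binder set of this file (each is a sub-family,
instantiated at `D`, `𝒜`).  A statement about hypothesis shapes, not about Liu's objects; our bookkeeping.
[cite: Liu2021, Thm. 4.18, Prop. 4.6 (1) and Def. 4.11] -/
theorem records_consistent (F E : Type) [Field F] [NumberField F] [IsTotallyReal F] [Field E] [NumberField E]
    [Algebra F E] [IsTotallyComplex E] [Algebra.IsQuadraticExtension F E] :
    ∃ (D : Thm418Data F E) (𝒜 : SmallCategory D.Obj), Liu2021.Thm418AsPrinted D ∧ Liu2021.Prop46_1AsPrinted D 𝒜 ∧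
      Liu2021.Def411AsPrinted D ∧ (∀ (ε : D.Eps) (χ : D.Chi), Nontrivial (D.omega ε χ)) ∧ Nonempty D.Chi := by
  classical
  letI : IsCMField E := isCMField F E
  obtain ⟨μ, hμ, hw, -⟩ := IdeleClassGroup.exists_isConjugateSymplectic_hasCMType (L := E)
    (IdeleClassGroup.cmTypeOf E (fun _ => -1) (by simp))
  let D : Thm418Data F E :=
    { n := 2, two_le_n := le_rfl, 𝕍 := PUnit, G := PUnit, Eps := PUnit, epsOf := fun _ => PUnit.unit, Chi := PUnit,
      μ := μ, isConjugateSymplectic := hμ, hasWeight_one := hw, Obj := Discrete PUnit,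
      omega := fun _ _ => ℂ, rho := fun _ _ => 1, Ω := fieldOfValues E μ, rhoΩ := 1,
      HomK := fun _ _ => fieldOfValues E μ, res := fun _ _ => AddMonoidHom.id _ }
  obtain ⟨i₀⟩ : Nonempty D.AdmIndex := nonempty_admIndex (D := D) PUnit.unit
  haveI : Subsingleton D.AdmIndex := ⟨fun a b => Subtype.ext (Subsingleton.elim (α := PUnit × PUnit) _ _)⟩
  have htop : IsOpenCompact (⊤ : Subgroup D.G) := by
    refine ⟨?_, ?_⟩ <;> rw [Subgroup.coe_top]
    · exact isOpen_univ
    · exact isCompact_univ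
  refine ⟨D, (inferInstance : SmallCategory (Discrete PUnit)), ?_, ?_, ?_,
    fun _ _ => (inferInstance : Nontrivial ℂ), ⟨PUnit.unit⟩⟩
  · -- `Thm418AsPrinted D` at the scalar datum (as in `Thm418Invariants.scalarDatum_consistent`)
    let e₁ : ℂ ⊗[fieldOfValues E μ] (fieldOfValues E μ) ≃ₗ[ℂ] ℂ :=
      TensorProduct.AlgebraTensorModule.rid (fieldOfValues E μ) ℂ ℂ
    let e₂ : ℂ ≃ₗ[ℂ] (⨁ _ : D.AdmIndex, ℂ) :=
      LinearEquiv.ofLinear (DirectSum.lof ℂ D.AdmIndex (fun _ => ℂ) i₀) (DirectSum.component ℂ D.AdmIndex (fun _ => ℂ) i₀)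
        (LinearMap.ext fun y => by
          show DirectSum.lof ℂ D.AdmIndex (fun _ => ℂ) i₀ (DirectSum.component ℂ D.AdmIndex (fun _ => ℂ) i₀ y) = y
          refine DFinsupp.ext fun j => ?_
          obtain rfl : j = i₀ := Subsingleton.elim _ _
          exact DirectSum.lof_apply ℂ (M := fun _ => ℂ) j _)
        (LinearMap.ext fun c => by
          show DirectSum.component ℂ D.AdmIndex (fun _ => ℂ) i₀ (DirectSum.lof ℂ D.AdmIndex (fun _ => ℂ) i₀ c) = c
          exact DirectSum.component.lof_self ℂ (M := fun _ => ℂ) i₀ c)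
    refine ⟨e₁.trans e₂, ?_, ?_, ?_, ?_⟩
    · intro g x i
      have h1 : (D.rhoΩ g).baseChange ℂ x = x := by
        show ((1 : Representation (fieldOfValues E μ) PUnit (fieldOfValues E μ)) g).baseChange ℂ x = x
        rw [MonoidHom.one_apply, LinearMap.baseChange_one]
        rfl
      rw [h1]
      rfl
    · intro Dμ
      refine ⟨⊤, htop, fun K _ _ => ⟨fun a b h => h, ?_⟩⟩
      ext x
      exact ⟨fun _ k _ => rfl, fun _ => ⟨x, rfl⟩⟩
    · exact fun i j _ => Subsingleton.elim i j
    · intro ε _ σ x _ i hne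
      exact absurd (Subsingleton.elim _ _) hne
  · -- `Prop46_1AsPrinted D 𝒜`: one object, connected, thin (as in `Prop46AsPrinted.prop46_1AsPrinted_satisfiable`)
    refine ⟨⟨⟨PUnit.unit⟩⟩, ?_, ?_⟩
    · refine zigzag_isConnected fun j₁ j₂ => ?_
      obtain ⟨⟨⟩⟩ := j₁
      obtain ⟨⟨⟩⟩ := j₂
      exact Relation.ReflTransGen.refl
    · intro a b
      infer_instance
  · -- `Def411AsPrinted D`: the trivial representation on `ℂ` is irreducible-or-zero, smooth, admissible
    intro ε χ
    refine ⟨fun W => ?_, fun v => ⟨⊤, ?_, fun k _ => rfl⟩, fun K _ => ?_⟩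
    · rcases Ideal.eq_bot_or_top (W.toSubmodule : Ideal ℂ) with hW | hW
      · exact Or.inl (Subrepresentation.toSubmodule_injective hW)
      · exact Or.inr (Subrepresentation.toSubmodule_injective hW)
    · rw [Subgroup.coe_top]
      exact isOpen_univ
    · infer_instance

/-- **The non-vanishing input `hnv` is load-bearing.**  At the ZERO DATUM — every `ω(μ, ε, χ) := 0`, `Ω(μ) := 0`,
`Hom_E(A_K, A_μ)_ℚ := 0`, one object — all three records `Thm418AsPrinted`, `Prop46_1AsPrinted`, `Def411AsPrinted` HOLD
while no `Hom_E(A_K, A_μ)_ℚ` has a non-zero element; so the conclusion of `exists_obj_homK_ne_zero_of_asPrinted` does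
not follow from the three records alone, and App. D Lem. D.1 (1) (non-vanishing of some `ω(μ,ε,χ)`, `n ≥ 3`) is a
genuine further input.  Our bookkeeping about hypothesis shapes. [cite: Liu2021, Thm. 4.18, Prop. 4.6 (1) and Def. 4.11] -/
theorem records_hold_at_zeroDatum (F E : Type) [Field F] [NumberField F] [IsTotallyReal F] [Field E] [NumberField E]
    [Algebra F E] [IsTotallyComplex E] [Algebra.IsQuadraticExtension F E] :
    ∃ (D : Thm418Data F E) (𝒜 : SmallCategory D.Obj), Liu2021.Thm418AsPrinted D ∧ Liu2021.Prop46_1AsPrinted D 𝒜 ∧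
      Liu2021.Def411AsPrinted D ∧ Nonempty D.Chi ∧
      ¬ ∃ (Dμ : D.Obj) (K : Subgroup D.G) (φ : D.HomK K Dμ), φ ≠ 0 := by
  classical
  letI : IsCMField E := isCMField F E
  obtain ⟨μ, hμ, hw, -⟩ := IdeleClassGroup.exists_isConjugateSymplectic_hasCMType (L := E)
    (IdeleClassGroup.cmTypeOf E (fun _ => -1) (by simp))
  let D : Thm418Data F E :=
    { n := 2, two_le_n := le_rfl, 𝕍 := PUnit, G := PUnit, Eps := PUnit, epsOf := fun _ => PUnit.unit, Chi := PUnit,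
      μ := μ, isConjugateSymplectic := hμ, hasWeight_one := hw, Obj := Discrete PUnit,
      omega := fun _ _ => PUnit, rho := fun _ _ => 1, Ω := PUnit, rhoΩ := 1,
      HomK := fun _ _ => PUnit, res := fun _ _ => 0 }
  have htop : IsOpenCompact (⊤ : Subgroup D.G) := by
    refine ⟨?_, ?_⟩ <;> rw [Subgroup.coe_top]
    · exact isOpen_univ
    · exact isCompact_univ
  refine ⟨D, (inferInstance : SmallCategory (Discrete PUnit)), ?_, ?_, ?_, ⟨PUnit.unit⟩, ?_⟩
  · -- `Thm418AsPrinted D`: both sides are zero modules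
    haveI : Subsingleton (ℂ ⊗[fieldOfValues E μ] D.Ω) := by
      refine ⟨fun x y => ?_⟩
      have hx : ∀ z : ℂ ⊗[fieldOfValues E μ] D.Ω, z = 0 := fun z => by
        induction z using TensorProduct.induction_on with
        | zero => rfl
        | tmul a b => rw [Subsingleton.elim b 0, TensorProduct.tmul_zero]
        | add a b ha hb => rw [ha, hb, add_zero]
      rw [hx x, hx y]
    haveI : Subsingleton (⨁ _ : D.AdmIndex, (PUnit : Type)) := by
      refine ⟨fun x y => DFinsupp.ext fun j => Subsingleton.elim _ _⟩
    let e : (ℂ ⊗[fieldOfValues E μ] D.Ω) ≃ₗ[ℂ] (⨁ i : D.AdmIndex, D.omegaAt i) :=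
      { toFun := fun _ => 0, map_add' := fun _ _ => by simp, map_smul' := fun _ _ => by simp,
        invFun := fun _ => 0, left_inv := fun x => Subsingleton.elim _ _, right_inv := fun x => Subsingleton.elim _ _ }
    refine ⟨e, fun g x i => Subsingleton.elim _ _, fun Dμ => ⟨⊤, htop, fun K _ _ => ⟨fun a b _ => Subsingleton.elim _ _, ?_⟩⟩,
      fun i j _ => Subtype.ext (Subsingleton.elim (α := PUnit × PUnit) _ _), fun ε _ σ x _ i _ => Subsingleton.elim _ _⟩
    ext x
    exact ⟨fun _ k _ => Subsingleton.elim _ _, fun _ => ⟨0, Subsingleton.elim _ _⟩⟩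
  · refine ⟨⟨⟨PUnit.unit⟩⟩, ?_, ?_⟩
    · refine zigzag_isConnected fun j₁ j₂ => ?_
      obtain ⟨⟨⟩⟩ := j₁
      obtain ⟨⟨⟩⟩ := j₂
      exact Relation.ReflTransGen.refl
    · intro a b
      infer_instance
  · intro ε χ
    refine ⟨fun W => Or.inl (Subrepresentation.toSubmodule_injective (Subsingleton.elim _ _)),
      fun v => ⟨⊤, ?_, fun k _ => Subsingleton.elim _ _⟩, fun K _ => ?_⟩
    · rw [Subgroup.coe_top]
      exact isOpen_univ
    · infer_instance
  · rintro ⟨Dμ, K, φ, hφ⟩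
    exact hφ (Subsingleton.elim _ _)

end Thm418Data

end Literature.NumberTheory.Automorphic.Liu2021

end
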